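import Mathlib
import HarnessLib
import HarnessLib.Audit
import Summits.AtomisticToContinuum.Statement
import HarnessLib.Audit.Status.Attr

/-!
Route: AnnealedZeroHorizon

DORMANT since 2026-08-26T14:19:22Z (reconciler: no traction for 6.6 d (last activity item-proof-filed at 2026-08-19T22:25:47Z); parked, not closed — `ledger route dormant route-AtomisticToContinuum-AnnealedZeroHorizon --off` to reactiva) — unstaffed, not closed; items shared with open routes are served there. `ledger route dormant <id> --off` reactivates.

# Route AnnealedZeroHorizon — Zero horizon — annealed statistical closure gives Euler up to the
first shock; past the first slip surface the same bookkeeping predicts O(1) realisation spread at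
fixed times

X = X₊ ∧ X₋ ("it suffices to show"), realising card zero-horizon-statistical-solutions (spine; its
Z1 = X₋, its Z2/Z3 pre-shock assembly (c) = X₊ in the sharpened ANNEALED form found while planning).
Conforming successor (D-0027 §2.1) of route ZeroHorizon, closed `not-a-thesis` by the 2026-08-15
audit only because its Assembly named the Literature constant instead of the sub-problem decl
`HydrodynamicLimit`; same items plus the deciding theorem; since the 2026-08-17 repair
(MeanSecondLaw refuted-misstated, AnnealedWeakStrong misstated ×3 leads) the X₊ inputs are the
re-typed kernel twins below and `closes : MeanMomentumClosureCut → MeanLocalSecondLaw →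
AnnealedWeakStrongR → HydrodynamicLimit` (sorry-free, the term `hAWS hMMC hMLS`).
X₊ (ANNEALED STATISTICAL CLOSURE, positive, pre-shock, → the conjunct; RE-TYPED 2026-08-17 after the
refutation of MeanSecondLaw and the three lead verdicts on AnnealedWeakStrong, following the leads'
kernel-twin retype `Cruxes/AnnealedWeakStrong/RETYPE_c2.lean` / `LeadC3-verdict.md` R-B): (i)
MeanMomentumClosureCut — the LAW-AVERAGED momentum balance of the kernel-mollified empirical fields
closes on the hard-sphere Euler flux m⊗m/ρ + p_cut𝟙 with the CUT pressure p_cut = ρθZ(min(ρσ³, η₁))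
(bands η₁ below a threshold η_c), tested against smooth SPACE-TIME vector fields, in the double
limit (kernel radius ℓ → 0 after N → ∞), uniformly on compact time intervals and for all times (mass
is exact: support MassContinuity; energy is used only through exact pathwise conservation, so NO
energy-flux closure is asked any more — the cubic heat-flux row was the kernel-checked obstruction
`AWS.energyFluxRem_not_dominated`); (ii) MeanLocalSecondLaw (the restated MeanSecondLaw) — the
law-averaged LOCAL, clamp-renormalised entropy inequality of the mollified fields: for smooth φ ≥ 0
the weak-form defect of ∂ₜ(ρZ_{a,b}(ŝ)) + div(Z_{a,b}(ŝ)m) ≥ 0, ŝ = 3/2 log θ − log ρ − F_cut(ρσ³)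
with the Gibbs-consistent cut excess free energy F_cut(η) = f_ex(min η η₁) + (Z(η₁)−1) log(max η
η₁/η₁), has mean ≤ ε — no comparison profile (the junk-pinned triple of `not_MeanSecondLaw` is
gone), f_ex evaluated only on [0, η₁] (the limsup-junk of hsExcessFreeEnergy above the band,
VERDICT-misstated.md, is gone), bounded clamped integrands (integrability is routine); mechanism
unchanged in spirit: Liouville invariance of the homogeneous Gibbs law + statics, now localised
(physical entropy can only be produced, locally, in mean); (iii) AnnealedWeakStrongR —
(i)+(ii)+Dirac initial data force convergence in probability to the classical solution while it
exists and stays dilute: Březina–Feireisl's relative ENERGY (BrezinaFeireisl2018 Thm 3.3, engine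
`brezinaFeireisl2018_thm_3_3_holds` proved in tree) run IN EXPECTATION at finite N and fixed kernel
— energy tested with the constant 1, entropy with θ̄ ≥ 0, momentum with ū-built fields, all
functionals LINEAR in the law, so plain expectations (annealed defects) suffice; no pathwise
(quenched) identification of limit points, no random Young measures, no propagation of chaos, no
NoConcentration event. The conclusion of AnnealedWeakStrongR is VERBATIM the packing-guarded
Statement body, so (i)–(iii) decide it outright (theorem `closes`). MeanFluxClosure (stmt-9256: raw
pressure, momentum AND energy; energy clause = the cubic heat-flux closure the relative-energy
method never consumes, raw hsPressure = the same EOS junk above the band, strategist census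
2026-08-17 no-strategy-short-of-summit in its untied frame) was DROPPED in the same repair (moot;
its text stays on the ledger and as the dropped-item record, its landed momentum pieces KS-a etc.
transfer to MeanMomentumClosureCut); DiluteSelfConsistency stays a shared, non-load-bearing support.
X₋ (ZERO HORIZON, negative, typed headline): ZeroHorizonSpread — for some smooth local-Gibbs
profile, some fixed macroscopic time t, test function χ and δ > 0, at arbitrarily small reduced
density, the law of the empirical momentum field ⟨m_N(t), χ⟩ concentrates around NO deterministic
centring (not even an N-dependent one): realisation-to-realisation differences are O(1). Mechanism:
a slip surface born at T_s ≥ T* spreads only viscously, w ≍ (Kn t′)^1/2 with Kn ≍ σ⁻²N^(−1/3), so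
the Kelvin–Helmholtz Ehrenfest time collapses from (2γ)⁻¹ log N to t′_E ≍ ν(log N)²/(Φ²ΔU²) ≍ Kn(log
N)² → 0 (ν ≍ c·Kn the kinematic viscosity, Φ ∈ [Φ_*, 1/√π] the optimal-growth constant of OnsetLawR,
positive at every Mach number and density ratio) and thermal N^(−1/2) seeds reach O(1) at fixed t >
T_s. X₋ implies nothing about the conjunct; with SpreadExcludesLimit / SpreadBoundsClassicalTime it
is the typed statement that the deterministic description ends (and, under the conjunct, that
classical solutions from those data die) by time t — the frontier of DETERMINISTIC hydrodynamics is
the first slip surface, and beyond it only limits IN LAW (statistical solutions) can be claimed.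
Lean: `MeanMomentumClosureCut ∧ MeanLocalSecondLaw ∧ AnnealedWeakStrongR ∧ ZeroHorizonSpread`

## Assembly
Frame statement X₊ → Statement: `Assembly := MeanMomentumClosureCut → MeanLocalSecondLaw →
HydrodynamicLimit` (restated 2026-08-17; definitionally the crux AnnealedWeakStrongR, whose
conclusion is the Statement body, so any proof of that crux closes it by `exact` and conversely — it
carries the crux's L-content, and the rank-5 crux stays the staffing key; the closes-shaped arrow `…
→ AnnealedWeakStrongR → HydrodynamicLimit` tried first in this repair is a tautology, gate flag
ground.trivial, hence this form). DECIDING THEOREM: `closes hMMC hMLS hAWS := hAWS hMMC hMLS`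
(glue.lean) — AnnealedWeakStrongR applied to MeanMomentumClosureCut and MeanLocalSecondLaw is
HydrodynamicLimit unfolded (d = 3 case of HydroLimitInBandDim, hydroLimitInBandDim_three_iff_root).
History: at open `… → AnnealedWeakStrong → DiluteSelfConsistency → HydrodynamicLimit` (stmt-9262,
proved against the unguarded abbrev); after the re-type p126922 `MeanFluxClosure → MeanSecondLaw →
HydrodynamicLimit` (stmt-17421, = AnnealedWeakStrong's content); after `not_MeanSecondLaw` (p151609,
2026-08-17) both AnnealedWeakStrong and that frame became vacuously provable (ex falso) and were
dropped, MeanSecondLaw staying in the negatives index as this line's settled negative edge.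
ZeroHorizonSpread is not an antecedent: it is the route's negative deliverable, tied to the conjunct
by the two Spread supports; MassContinuity (proved) and the landed AWS.* / S1 / S3a–c files of the
old line are lemmas for the prover of AnnealedWeakStrongR.

Rationale: WHY THIS LINE. Statistical solutions (FjordholmLanthalerMishra2017; FjordholmEtAl2020, Def. 27 and
Lemma 28/Thm 30) are time-parametrised laws on fields whose weak–strong uniqueness with a Dirac
initial law is proved by Dafermos' relative entropy computed IN EXPECTATION — every step
(first-moment equation tested with η′(Ū), global entropy inequality, flux remainder) is linear in
the law; transplanted to the fixed-density hard-sphere gas (relative-energy technique of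
Dafermos1979 / BrezinaFeireisl2018 for the complete Euler system in place of FLMW's bounded-Hessian
hypotheses) this says the microscopic input for the conjunct is ANNEALED: mean flux closure and a
mean second law, the latter obtainable from Liouville invariance plus Georgii1994-type large
deviations of the invariant Gibbs state (imported areas: statistical/measure-valued solutions of
hyperbolic systems and their numerics; large deviations for Gibbs point processes). The same
statistical bookkeeping, run past the first singularity with the vortex-sheet stability theory of
Miles1958 / FejerMiles1963 / CoulombelSecchi2004 and the mixing-layer phenomenology of
BrownRoshko1974, gives the card's zero-horizon law and the typed negative statement
ZeroHorizonSpread: thermal noise is amplified to macroscopic randomness in time Kn(log N)² → 0 after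
a slip surface forms (ThalabardBecMailybaev2020, BandakEtAl2024 and EyinkPeng2025 reach the same
conclusion from fluctuating hydrodynamics; KadauEtAl2004 see thermally seeded instabilities in MD) —
so beyond the first slip surface the hydrodynamic limit can only hold in law, with FLM statistical
solutions as the limit object. What prior routes do not do: RelEntropyErgodic / ChaoticMixing /
VanishingNoise / DenseKineticExpansion / OneParticleInfluence prove STRONG (microscopic) local
equilibrium; DissipativeWeakStrong asks for QUENCHED mv closure (every limit point of the joint law
a.s. a dissipative mv solution, informal); the parallel route EntropyBookkeeping (opened the same
hour) types the same modulated-entropy architecture in QUENCHED form — MomentumFluxLocality /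
EnergyFluxLocality (defects → 0 in probability, pre-shock frame), MacroSecondLaw (w.h.p.), a
pathwise Gronwall on a NoConcentration event — and KnudsenRate types the log N EhrenfestHorizon for
smooth Kolmogorov shear at times C log N. This route's deltas: (1) every X₊ item is ANNEALED (plain
expectations: weaker conclusions than the quenched / L¹(P_N) ones under uniform integrability, so
easier cruxes), and AnnealedWeakStrongR shows they still suffice because the Březina–Feireisl
relative-energy inequality is linear in the law (only E-pairings with test fields built from ū, θ̄
enter) — no NoConcentration event, no good set, the price being state-space control in mean, paid
since the 2026-08-17 repair by the CUT equation of state and the CLAMPED local entropy (bounded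
integrands on every window state) instead of the raw limsup-defined hsExcessFreeEnergy; (2)
MeanMomentumClosureCut and MeanLocalSecondLaw are UNTIED (no Euler solution in their hypotheses) and
stated for ALL times, as the microscopic inputs the post-shock statistical-solution programme
(limits in law) also needs — in this they differ from their tied, kinetic-window, L¹ twins
FluxClosure / EntropyAdmissibility of route BoxDissipativeWeakStrong (macroscopic continuous kernels
here, so no fine-scale statics K0 is needed: the t = 0 input is the Statement's own macroscopic LLN,
landed as S1 `stub_timeZeroMeanConvergence`); (3) X₋ is the fixed-time (zero-horizon) negative for
dynamically created slip surfaces, against arbitrary N-dependent centrings, where EhrenfestHorizon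
needs t_N ≍ log N for smooth shear; the negatives index was empty at filing. REPAIR 2026-08-17 (this
rev): the original X₊ triple MeanFluxClosure / MeanSecondLaw / AnnealedWeakStrong died at its second
member — `not_MeanSecondLaw` (p151609; the comparison triple (ρ₁,u₁,θ₁) was pinned only through junk
Bochner integrals of TendstoHydroFieldsAt, refuted-misstated) on top of the independent `verdict:
misstated` of lead c1 (raw hsExcessFreeEnergy evaluated at window packings (1.2, √2] that FCC clumps
reach for EVERY kernel; `Integrable S` undecidable) — and three leads on AnnealedWeakStrong (c1
dossier, c2, c3 verdicts in Cruxes/AnnealedWeakStrong/) showed the GLOBAL mean second law cannot be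
consumed: the Dafermos/FLMW Bregman functional forces the energy balance to be tested with
−1/θ̄(t,x), whose CUBIC energy-flux remainder is not dominated by the quadratic relative entropy
(`AWS.energyFluxRem_not_dominated`, kernel-checked). The provers' minimal C′ (continuity of the
triple + kernel height σ³k ≤ η_b with ∀ℓ) was NOT adopted: the height bound forces ℓ ≳ 0.62 σ
η_b^(−1/3), and the weak–strong Grönwall started from the fine-grained entropy budget ∫η(U₀) then
keeps an O(ℓ²) = O(σ²) Jensen floor, so exact convergence at FIXED σ — what the Statement asks —
could not follow. Adopted instead: the leads' retype R-B (RETYPE_c2.lean, endorsed by c3) —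
Březina–Feireisl relative ENERGY (energy tested with 1, exact; entropy tested LOCALLY with θ̄;
momentum with cut pressure), i.e. the three new items MeanMomentumClosureCut / MeanLocalSecondLaw /
AnnealedWeakStrongR, with two planner changes: bands `∃ η_c ∀ η₁ < η_c` (never `∀ η₁ > 0`, which
would re-admit the EOS junk above the analytic band) and uniformity in τ on compact time intervals
(so the Grönwall has one kernel and one N-range for all τ ≤ t). MeanFluxClosure (raw pressure,
energy clause with the cubic heat flux KE-b, strategist census `no-strategy-short-of-summit` in the
untied frame) was dropped with them (moot; the gate has no `aside` badge — a first re-badge attempt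
to `aside` was recorded but unrenderable, KeyError, and had to be cleared by the drop).

RANKED CRUXES. #2 ZeroHorizonSpread (crux) — (card Z1, zero-horizon variance explosion, in centring
form) there are continuous positive profiles (a₀, θ₀) and u₀, a time t > 0, a continuous χ and δ > 0
such that for every σ₀ > 0 some reduced density 0 < σ < σ₀ has: for every family of hard-sphere
flows and EVERY deterministic centring c : ℕ → V3, frequently in N the local Gibbs law gives
probability ≥ δ to {‖⟨empirical momentum field at time t, χ⟩ − c_N‖ > δ}. Equivalently two
independent realisations differ by O(1) with non-vanishing probability; intended witness: smoothed
four-quadrant / oblique-shock data on 𝕋³ (functions of two coordinates) whose hs-Euler evolution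
produces a SUBSONIC slip surface at T_s, observed at any fixed t > T_s. [difficulty: open-problem]
(why it might fail: hs-Euler slip surfaces from generic smooth data might be born with macroscopic
width (horizon ≍ log N as for smooth shear); compressibility/density ratio only delay onset by a
constant factor (OnsetLawR; BlumenDrazinBillings1975, BalsaGoldstein1990), but nonlinear saturation
at mesoscopic amplitude could keep the spread o(1).) [ThalabardBecMailybaev2020, BandakEtAl2024,
EyinkPeng2025, Miles1958, FejerMiles1963, CoulombelSecchi2004, CoulombelSecchi2008, BrownRoshko1974,
ChangChenYang1995, KadauEtAl2004, BlumenDrazinBillings1975, BalsaGoldstein1990]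
#3 MeanMomentumClosureCut (crux; NEW 2026-08-17, the kernel/annealed twin of
BoxDissipativeWeakStrong.FluxClosure; supersedes the momentum clause of MeanFluxClosure on the
load-bearing path) — ∃ η_c > 0 such that for every band 0 < η₁ < η_c and all continuous positive
profiles there is σ₀ > 0 with: for 0 < σ < σ₀, every flow family, every horizon T′ > 0, every smooth
space-time vector field w on [0,T′)×𝕋³, every T₁ < T′ and ε > 0 there is ℓ > 0 such that for every
continuous probability kernel k supported in the ℓ-ball, eventually in N, FOR ALL τ ∈ [0,T₁], the
pathwise momentum-balance defect ⟨m^k(τ), w(τ)⟩ − ⟨m^k(0), w(0)⟩ − ∫₀^τ∫ (m^k·∂ₜw + (m^k⊗m^k/ρ^k):∇w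
+ p_cut div w) dx ds, p_cut = ρ^kθ^kZ(min(ρ^kσ³, η₁)), θ^k = ⅔(E^k/ρ^k − |m^k|²/2(ρ^k)²), is
integrable under the local Gibbs law with |mean| ≤ ε. Content: the traceless window velocity
covariance and (collisional transfer − ρθ(Z−1)𝟙) vanish IN MEAN after space-time averaging; windows
above the band are flux-negligible; no energy/heat-flux closure. The landed momentum pieces of
MeanFluxClosure's line (KS-a StreamingStressCommutator p144915, CollisionalStressClosure*,
DeviatoricStressClosure*) transfer. [difficulty: open-problem] (why it might fail: local equilibrium
IN MEAN of the deterministic momentum current at fixed σ with no mixing theorem; the untied all-time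
form must absorb sub-kernel Reynolds stresses after shocks as ℓ → 0.) [Spohn1991,
OllaVaradhanYau1993, BrezinaFeireisl2018, KipnisLandim1999,
Literature.Barriers.AtomisticToContinuum.BoltzmannHypothesisBarrierNarrow]
#4 MeanLocalSecondLaw (crux; NEW 2026-08-17 = the RESTATED MeanSecondLaw, stmt-9257
refuted-misstated by not_MeanSecondLaw; kernel/annealed twin of
BoxDissipativeWeakStrong.EntropyAdmissibility) — same frame (∃ η_c ∀ η₁ < η_c ∀ profiles ∃ σ₀ ∀ σ <
σ₀ ∀ Φ ∀ T′ > 0), then for all clamps a < b, every smooth φ ≥ 0 on [0,T′)×𝕋³, T₁ < T′ and ε > 0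
there is ℓ > 0 such that for every kernel in the ℓ-ball, eventually in N, for all τ ∈ [0,T₁], the
renormalised entropy-balance defect ∫₀^τ∫ (ρ^k Z_{a,b}(ŝ) ∂ₜφ + Z_{a,b}(ŝ) m^k·∇φ) dx ds − [∫ ρ^k
Z_{a,b}(ŝ) φ]₀^τ, ŝ = 3/2 log θ^k − log ρ^k − F_cut(ρ^kσ³), F_cut(η) = f_ex(min η η₁) + (Z(η₁)−1)
log(max η η₁/η₁) (Gibbs-consistent with p_cut), Z_{a,b} = max a ∘ min · b, is integrable with MEAN ≤
ε (it is ≤ 0 for exact entropy solutions: physical entropy is only produced, locally, in mean). What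
changed against the refuted item: no comparison triple (the c2 witness pinned (ρ₁,u₁,θ₁) only
through junk Bochner integrals), f_ex only on [0,η₁] (the c1 verdict: limsup junk above the band),
clamped bounded integrands (integrability routine), LOCAL instead of global (consumable by the
relative ENERGY method, c3 §A). Mechanism kept: Liouville invariance of the homogeneous Gibbs law +
statics (InitialEntropyValue proved; the landed stub_liouvilleEntropyTransfer /
stub_conservedTotalsInLaw of the old line), localised. [difficulty: open-problem] (why it might
fail: no H-theorem for deterministic spheres: needs entropy flux = Z(ŝ)m^k in mean (no Euler-order
heat current) and near-local-equilibrium window statistics at positive times; ρs concave, so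
sub-kernel fluctuations push the wrong way.) [BrezinaFeireisl2018, FeireislNovotny2012,
ChenFrid2000, Georgii1994, Spohn1991, FjordholmEtAl2020]
#5 AnnealedWeakStrongR (crux; NEW 2026-08-17, replaces AnnealedWeakStrong stmt-9258, which became
vacuous ex falso and was declared misstated by leads c1–c3) — MeanMomentumClosureCut →
MeanLocalSecondLaw → [VERBATIM the packing-guarded Statement body: ∃ η₀ > 0 ∀ continuous positive
profiles ∃ σ₀ ∀ σ < σ₀ ∀ classical hs-Euler solutions on [0,T) with ρσ³ < η₀ throughout ∀ flow
families whose local Gibbs fields converge at t = 0: fields converge in probability at every t < T].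
Intended proof: obtain η_c from both hypotheses, set η₁ := η_c′/2, η₀ := η₁/2; per (σ, solution, t <
T): Březina–Feireisl Thm 3.3 (engine `brezinaFeireisl2018_thm_3_3_holds`, pointwise machinery
MVRelativeEnergy*, HsEntropyConvex / HsEosLowDensity proved) run IN EXPECTATION at finite N on
e^k_N(τ) = E∫ℰ_{Z_{a,b}}(U^k_N(τ,x) | ρ,θ,u(τ,x)) dx for the cut law — energy tested with 1 (exact
pathwise conservation), continuity exact (MassContinuity, space-time version), momentum from
MeanMomentumClosureCut with ū-built w, entropy from MeanLocalSecondLaw with θ̄-built φ, uniformly in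
τ ≤ t; then ℓ → 0 (bias O(ℓ²) of k∗Ū(0); time-zero input = the Statement's macroscopic LLN, S1
p145914), then the landed S3b/S3c (p146993/p145913) turn e^k_N → 0 into TendstoHydroFieldsAt. [deps:
MeanMomentumClosureCut, MeanLocalSecondLaw] [difficulty: L] (why it might fail: BF18 un-clamps by an
a.s. entropy minimum principle and works with bounded-support Young measures; here vacuum/cold/dense
windows are charged at finite N and only MEAN defects are known: coercivity of the clamped relative
energy for the cut EOS on all window states is unprinted.) [BrezinaFeireisl2018,
BrezinaFeireisl2018Revisited, FeireislNovotny2012, Dafermos1979, FjordholmEtAl2020, Wiedemann2018]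
(dropped 2026-08-17) MeanFluxClosure (stmt-9256, was crux rank 3) — the original untied all-time
momentum AND energy closure with the RAW pressure (lead line `registered`: KS-a p144915 / KE-a1
p144446 landed, KS-b/CS/KE-a2/KE-b/CE open at the drop; strategist census 2026-08-17:
no-strategy-short-of-summit in the untied frame, restatement recommended). Its energy clause carried
the cubic heat-flux closure KE-b and its raw hsPressure the same EOS junk above the band (c3 §C);
its momentum content lives on in MeanMomentumClosureCut (cut pressure, space-time tests), to which
the landed pieces transfer; closed moot by the drop (the gate offers no `aside` badge). [Spohn1991,
OllaVaradhanYau1993, FjordholmLanthalerMishra2017, FjordholmEtAl2020, KipnisLandim1999]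
#6 OnsetLawR (crux, INFORMAL, stmt-AtomisticToContinuum-13797; replaces OnsetLaw stmt-9502, dropped
refuted-misstated 2026-08-15) — (card Z4, the linear mechanism behind ZeroHorizonSpread) for
hard-sphere Navier–Stokes–Fourier (ν ≍ c·Kn) linearised around the viscously spreading tangential
discontinuity (jump ΔU ≠ 0, density ratio r, width (νt′)^½, d ∈ {2,3}), with G the optimal
Chu-energy amplification from t′₀ = Kn and Φ := log G/(|ΔU|(t′/ν)^½), in the window N → ∞, Kn ≪ t′ ≪
1: (i) limsup Φ ≤ Φ^E (energy ceiling, 1/√π at r = 1); (ii) THE CRUX: liminf Φ ≥ Φ_*(ΔU/c, r, d) > 0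
at EVERY Mach number and density ratio; (iii) hence N^(−1/2) thermal seeds reach O(1) by t′_E ≤
ν(log N)²/(Φ_*²ΔU²)(1+o(1)) → 0, Re_w ≍ log N/Φ_* → ∞. [difficulty: L] (why it might fail:
saturation of the energy-bound exponent by OPTIMAL perturbations on a time-dependent, stratified
compressible base is unproved: at high M_c or extreme r the rates might integrate to o((t′/ν)^½);
nonlinear saturation below O(1) would decouple onset from ZeroHorizonSpread.)
[BlumenDrazinBillings1975, BalsaGoldstein1990, CriminaleJacksonJoslin2018, Chimonas1970,
HanifiSchmidHenningson1996, ThalabardBecMailybaev2020, BandakEtAl2024, BardosTitiWiedemann2012]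
#9 DiluteSelfConsistency (support) — (shared verbatim with route ImplosionLoophole,
stmt-AtomisticToContinuum-3091; it discharged the packing guard of AnnealedWeakStrong against the
pre-re-type unguarded Statement and is no longer used by `closes` since 2026-08-16 — kept as the
support that upgrades the guarded conclusion to the unguarded Literature conjecture) for every η > 0
and all continuous positive profiles there is σ₀ such that for σ < σ₀ every classical hs-Euler
solution whose t = 0 fields are the LLN limit of the local Gibbs laws keeps ρ_t(x)σ³ < η on [0,T).
[difficulty: open-problem] (why it might fail: owned by route ImplosionLoophole: its negation
DenseExcursion (implosion tracking) is a live crux there.) [Sideris1985, LukSpeck2024,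
CaolaboraEtAl2025, BuckmasterCaolaboraGomezserrano2025]
#9 MassContinuity (support) — (exact continuity equation in the same annealed format; provable from
the HardSphereFlow trajectory axioms alone) for every σ > 0, continuous positive profiles, flow
family, N, t₁ ≤ t₂ and smooth ψ, the pathwise defect ⟨ρ_N(t₂),ψ⟩ − ⟨ρ_N(t₁),ψ⟩ − ∫_{t₁}^{t₂} Σᵢ
⟨m_N(s), ∂ᵢψ⟩ᵢ ds is integrable under the local Gibbs law with integral 0: it vanishes identically
on the good set (free flight + continuity of positions, FTC for piecewise-C¹ s ↦ ψ(x_k(s))) and the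
law is absolutely continuous w.r.t. Liouville (particleLaw = withDensity). Feeds the mass equation
to the prover of AnnealedWeakStrongR (space-time test functions: same proof). [difficulty: M]
[GST2013, Alexander1975, Spohn1991]
#9 SpreadExcludesLimit (support) — (glue, provable now; proof in the planner's Sketch.lean) for any
laws P_N, flows, time t, continuous χ and δ > 0: if for every centring c : ℕ → V3 frequently
P_N{‖⟨m_N(t),χ⟩ − c_N‖ > δ} ≥ δ, then NO fields (ρ,u,θ) whatsoever satisfy TendstoHydroFieldsAt P Φ
ρ u θ t. Makes ZeroHorizonSpread a typed refutation of every deterministic description at time t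
(classical, weak, mv-barycentre …). [difficulty: provable-now] [Spohn1991]
#9 SpreadBoundsClassicalTime (support) — (glue, provable now; proof in Sketch.lean) if
HydrodynamicLimitFor σ holds and the spread of ZeroHorizonSpread occurs at (σ, profiles, t ≥ 0, χ,
δ) for a flow family Φ, then every classical hs-Euler solution on [0,T) whose time-0 fields are the
local-Gibbs LLN limit along Φ has T ≤ t: under the conjunct, randomisation by time t is a
particle-level certificate of classical breakdown before t (contrapositive: global classical
solutions ⇒ no spread ever). [difficulty: provable-now] [Spohn1991, Sideris1985]

TWO-LAYER PLAN. Foreseen glued splits (none filed now, k ≤ 3, depth 1): MeanMomentumClosureCut ⇐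
DeviatoricStressClosure (mean traceless window velocity covariance → 0 after space-time averaging;
KS-b of the old line) → CollisionalVirialClosureCut (mean collisional transfer = ρθ(Z_cut − 1)𝟙; CS
of the old line, now inside the band by the cut) → StreamingCommutators (KS-a-type, landed);
MeanLocalSecondLaw ⇐ LocalLiouvilleEntropyTransfer (space-localised H(P_t|G) bookkeeping with
φ-weights; stub_liouvilleEntropyTransfer landed for φ ≡ 1) → WindowEntropyStatics (block LDP /
sub-unit MGF of the clamped window entropy under the homogeneous law at packing ≤ η₁: the
fixed-kernel analogue of MacroClosureLine.HomogeneousBlockMGF) → NoEulerHeatCurrentInMean;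
AnnealedWeakStrongR ⇐ MeanRelEnergyInequality (BF18 (3.12)-type inequality for e^k_N in expectation,
uniform in τ ≤ t) → ClampedCoercivity (ℰ_{Z_{a,b}} ≥ c·dist on all window states for the cut EOS) →
(landed) S3b/S3c; ZeroHorizonSpread ⇐ OnsetLawR (linear PDE, every Mach number; filed informal at
rank 6) → NonlinearSaturationSpread.

KILL CRITERIA. Refutation of MeanMomentumClosureCut IN SUBSTANCE (a smooth pre-shock datum for which
the law-averaged momentum flux stays off m⊗m/ρ + p_cut𝟙 at leading order, inside the band) closes
the route `refuted:MeanMomentumClosureCut` and, since annealed cut closure is the weakest closure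
any route uses, would all but refute the conjunct — file ¬HydrodynamicLimitFor then; a refutation
through its untied post-shock surplus (sub-kernel Reynolds stress after blow-up) forces the TIED
restatement (hypothesise the classical solution, τ < T) instead. MeanLocalSecondLaw refuted in
substance (mean local entropy DESTRUCTION at a positive macroscopic resolution, inside the band,
pre-shock) kills every entropy-method route and is filed as a barrier; refuted through a typing
corner it is restated again (the 2026-08-17 refutation of MeanSecondLaw — junk-pinned comparison
triple — was such a corner and led to the present local clamped form, as this paragraph had
foreseen: 'truncated-entropy restatement, not a close'). AnnealedWeakStrongR is a theorem-shaped PDE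
item: a counterexample can only come from the clamped-coercivity issue named in its why-line and
forces a restatement with a density/temperature floor in mean. Refutation of ZeroHorizonSpread in
the intended witness class (spread o(1) at fixed t after a subsonic slip surface, at N with Kn(log
N)² ≪ 1) retires the card's headline but leaves X₊ intact — the route would then be edited to drop
X₋. OnsetLawR(ii) refuted in some regime (Φ_* = 0) narrows ZeroHorizonSpread's witness class to the
remaining regimes; refuted for the incompressible-like layer (r = 1, M_c → 0) it retires the
mechanism and X₋ is dropped unless the MD falsifier has fired. DiluteSelfConsistency refuted
(DenseExcursion proved in route ImplosionLoophole) no longer touches this route: since the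
2026-08-16 re-type the Statement is the packing-guarded conjunct and `closes` does not use it (the
repair foreseen here — restate the assembly on HydroLimitInBand — is exactly what the re-type did).
RelEntropyVanishing or L2HydroFields proved elsewhere moots X₊ (not X₋).

NOT DECOMPOSED YET. Deliberately not filed at open: (a) the onset law Z4 is filed INFORMAL as
OnsetLawR (rank 6, stmt-13797), its predecessor OnsetLaw stmt-9502 having been dropped
refuted-misstated (2-D supersonic 'no growth' clause false for layers of nonzero width:
BlumenDrazinBillings1975, BalsaGoldstein1990, CriminaleJacksonJoslin2018 (5.56)); typed once
linearisedHsNSF / optimalAmplification land (inviscid proxy over IsLinearizedHsEulerSolution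
possible now); (b) the hard-DISK litmus (d = 2, Kn ≍ σ⁻¹N^(−1/2)), REDESIGNED without a supersonic
'no-spread' arm (Miles' 2√2·c and the Lopatinskii condition of CoulombelSecchi2004 concern the
zero-thickness sheet): controls = the pre-shock window t < T_s and a smooth-shear datum without slip
surface (variance O(N⁻¹) up to the ≍ log N horizon of route KnudsenRate); a supersonic slip line is
only a DELAYED-onset arm (t′_E ∝ Φ_*⁻²) — needs 2-D hsDiameter/localGibbsLaw; (c) the positive
post-shock statement HL-S (Law(U_N(t)) ⇒ μ_t, a dissipative statistical solution of hs-Euler, for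
all t) and the CONDITIONAL-MEAN closure ⇒ FLM moment hierarchy step (card Z2 proper), which need a
`DissipativeStatisticalSolution` definition (request still deferred); (d) universality across
regularisations (card Z5, docking target only); (e) constants of the relative-energy inequality for
the cut hs-EOS, the space-time MassContinuity, uniform integrability lemmas for local Gibbs velocity
moments, joint measurability of (s,z) ↦ Φ_s z on the good set (children of AnnealedWeakStrongR /
MeanMomentumClosureCut, layer 2); (f) the TIED restatements of MeanMomentumClosureCut /
MeanLocalSecondLaw (pre-shock frame, as in BoxDissipativeWeakStrong) — held in reserve should the
untied all-time surplus prove unreachable (MeanFluxClosure strategist census 2026-08-17).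

CHEAPEST FALSIFIER. For X₋: a 2-D hard-disk event-driven MD run (kit) — N = 10⁶–10⁷ disks, 20
realisations of one smoothed four-quadrant datum producing a subsonic, r ≈ 1 slip line (fastest
onset): the realisation variance of ⟨m_N(t), χ⟩ near the slip line must stay O(N⁻¹) for t < T_s and
jump to O(1) within t′ ≈ 25–40·ν(log N)²/ΔU² of the triple point at M_c → 0 (later, ∝ Φ_*⁻², at
finite M_c; never before πν(log N)²/ΔU²); controls = the pre-shock window and a smooth-shear datum
without slip surface (O(N⁻¹) until ≍ log N); no jump at N with Kn(log N)² ≪ 1 kills the mechanism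
(not run: compute-free hub, multi-hour MD campaign). For OnsetLawR(ii): a direct–adjoint
optimal-growth computation for linearised compressible NS around the spreading erf layer (M_c ∈
{0.3, 1.2, 2}, r ∈ {1, 4}): Φ(t′) must plateau above 0. For X₊ (after the repair): (a) the
constant-profile case of MeanMomentumClosureCut / MeanLocalSecondLaw (P_t = P₀ by invariance; mean
defects must vanish by stationarity + translation invariance — an in-Lean special case, cf. the
MeanFluxClosure strategist's N2); (b) the t = 0⁺ sign of the mean clamped entropy defect for one
non-constant smooth profile (statics only: Jensen surplus of the window-averaged state, which must
be absorbed by ℓ → 0 — a wrong ORDER of quantifiers would be refutable exactly here); (c) for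
AnnealedWeakStrongR, whether BF18's coercivity (3.19)–(3.21) survives the clamp without the a.s.
minimum principle — a reading of BrezinaFeireisl2018 §3.2.1 against the in-tree `MVRelativeEnergy*`
files (the old falsifier — does the remainder bound survive the raw limsup EOS — fired: it does not,
hence the cut).

NUMBERS. Kn ≍ σ⁻²(N+1)^(−1/3) (mean free path / box at reduced density σ³); smooth-shear Ehrenfest
horizon t_E ≍ (2γ)⁻¹ log N (card knudsen-rate-law-and-ehrenfest-horizon); slip-surface onset t′_E =
ν(log N)²/(Φ²ΔU²) (N^(−1/2) seed), Φ ∈ [Φ_*, 1/√π]: ≥ πν(log N)²/ΔU² (energy ceiling), ≈ 25–40·ν(log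
N)²/ΔU² for the incompressible-like layer (modal Φ* ≈ 0.165–0.2), ×10³–10⁵ later at M = 1.5–3 in 2-D
(Φ* = 6.2e-3 … 4.6e-4; refuter evidence on stmt-9502); Re_w at onset ≍ log N/Φ; the card's Kn(log
N)²/(64ΔU²) is superseded (below the ceiling); the 2-D vortex-SHEET threshold ΔU > 2√2·c (Miles1958;
CoulombelSecchi2004, CoulombelSecchi2008; M_CR of CriminaleJacksonJoslin2018 (5.56)), none in 3-D
(FejerMiles1963), is a zero-thickness statement — layers of nonzero width are unstable at every Mach
number (BlumenDrazinBillings1975, DrazinDavey1977, BalsaGoldstein1990, TamHu1989); mixing-layer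
growth δ_mix ≍ c_BR ΔU t′, c_BR ≈ 0.16–0.18 (BrownRoshko1974); FLMW weak–strong: W₂(μ_t, δ_{v(t)}) ≤
e^{Ct} W₂(μ_0, δ_{v(0)}) (FjordholmEtAl2020 Lemma 28). Items after the 2026-08-17 repair: 9 typed (4
cruxes ZeroHorizonSpread / MeanMomentumClosureCut / MeanLocalSecondLaw / AnnealedWeakStrongR, 4
supports, 1 assembly frame) + the deciding theorem `closes` + 1 informal crux OnsetLawR (rank 6,
stmt-13797); dropped: MeanSecondLaw (stmt-9257, refuted-misstated, negatives index),
AnnealedWeakStrong (stmt-9258, vacuous after the refutation) and MeanFluxClosure (stmt-9256, no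
longer load-bearing, moot); the conclusion of AnnealedWeakStrongR is verbatim the re-typed Statement
body (so `closes := fun hMMC hMLS hAWS => hAWS hMMC hMLS`), and DiluteSelfConsistency is verbatim
stmt-AtomisticToContinuum-3091. Signature sizes: MeanMomentumClosureCut 2284, MeanLocalSecondLaw
2381, AnnealedWeakStrongR 1212 chars (Sketch.lean rc 0, std axioms).

DEFINITION REQUESTS. Filed 2026-08-15 for OnsetLawR (stmt-13797), topic
Literature/Analysis/FluidPDE: `linearisedHsNSF` (hard-sphere Navier–Stokes–Fourier, Boltzmann–Enskog
transport, linearised around a prescribed smooth background on 𝕋^d; cf. the inviscid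
IsLinearizedHsEulerSolution) and `optimalAmplification` (Chu energy, optimal growth between two
times; HanifiSchmidHenningson1996). Still deferred: `DissipativeStatisticalSolution`
(FjordholmEtAl2020 Def. 27).

Novelty: Searches (2026-08-15): `lit search --source crossref "statistical solutions hyperbolic systems
conservation laws numerical approximation Fjordholm Lye Mishra Weber"` (8; FjordholmEtAl2020,
FjordholmLanthalerMishra2017, FKMT2015 found); `lit search --source crossref "statistical solutions
Euler equations vanishing viscosity limit particle system hydrodynamic limit"` (7; only PDE
vanishing-viscosity papers, Chae 1991 doi:10.1016/0022-247x(91)90013-p, Basarić 2020,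
Feireisl–Klingenberg–Markfelder 2022 — no particle system); `lit search --source crossref
"spontaneous stochasticity Kelvin-Helmholtz thermal fluctuations molecular dynamics"` (8; 0
relevant); `lit search --source zbmath "statistical solutions weak-strong uniqueness Euler"` (5;
stochastic-NS weak–strong only); `lit galaxy search "spontaneous stochasticity" --star all` (16:
Mailybaev–Raibekas arXiv:2111.03666 rigorous toy model, Eyink–Bandak–Goldenfeld arXiv:2107.13954,
Biferale et al. arXiv:1802.05021); `lit galaxy search "dissipative statistical solution" --star pdf`
(2: Giesselmann–Meyer–Rohde arXiv:1912.04323 a-posteriori relative entropy for statistical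
solutions); `lit frontier AtomisticToContinuum --since 2021` (30, none on statistical solutions or
fluctuating hydrodynamics of hard spheres); `lit bridges AtomisticToContinuum --cross any`; `lit
read arxiv:1906.02536` pp. 10–12 (Def. 27, Lemma 28, Thm 30 verified); local searchd and
OpenAlex/arXiv/S2 were down or rate-limited this session (noted).
Nearest prior ar  [refs: 10.1016/0022-247x(91, 10.1142/s0218202520500141:, 10.1103/physrevlett.132.104002, 10.1088/1361-6544/adf605:, 2111.03666, 2107.13954, 1802.05021, 1912.04323, 1906.02536, doi:10.1016/0022-247x, arxiv:1906.02536, doi:10.1142/s0218202520500141, doi:10.1103/physrevlett.132.104002, doi:10.1088/1361-6544/adf605, FjordholmEtAl2020, FjordholmLanthalerMishra2017, BandakEtAl2024, EyinkPeng2025, ThalabardBecM]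

Barriers (technique_class: statistical-solutions annealed-closure instability-horizon): - technique_class: statistical-solutions annealed-closure instability-horizon
- Literature.Barriers.AtomisticToContinuum.ShockFormationBarrier: respected, not evaded, by X₊
(AnnealedWeakStrong is a weak–strong argument and stops at the classical time T, exactly the
conjunct's scope); X₋ is the route's account of what lies beyond: not a deterministic limit at all
after the first slip surface, so the "global strengthening" the barrier blocks is claimed false in
law-degenerate form and re-targeted at limits in law.
- Literature.Barriers.AtomisticToContinuum.WildSolutionsBarrier: sidestepped by changing the limit
object — nothing here selects an admissible weak solution past T; ZeroHorizonSpread predicts the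
physical ensemble spreads over them (EyinkPeng2025 reads non-uniqueness the same way); uniqueness of
the statistical limit (FLM conjecture) is docked, not claimed.
- Literature.Barriers.AtomisticToContinuum.BoltzmannHypothesisBarrier: it does not evade it; the bet
is that the ergodic input is needed only in its weakest, ANNEALED form (MeanFluxClosure:
expectations of flux defects, no classification of invariant measures, no pathwise statement) and
that the second law comes for free from Liouville + statics (MeanSecondLaw), leaving one honest open
crux instead of two.
- Literature.Barriers.AtomisticToContinuum.MacroErgodicityBarrier: same answer as for the Boltzmann
hypothesis — MeanFluxClosure is the macro-ergodic input in mean form; not evaded, isolated and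
typed.
- Literatu

Novelty grade: new-combination — route-review (refuter c310f3d6; reviewed as ZeroHorizon, re-filed conforming as AnnealedZeroHorizon with IDENTICAL item signatures 9255-9261, Assembly 9262 proved in-file as `closes`). ELAB: all decls rc0; glue supports 9260/9261 PROVED (Glue2.lean attached); AnnealedWeakStrong's conclusion = HydroL (refuter refuter-rreview-route-AtomisticToContinu-c310f3d6-0, 2026-08-15T14:02:59Z; prior: route-AtomisticToContinuum-EntropyBookkeeping, route-AtomisticToContinuum-KnudsenRate, arxiv:1906.02536, doi:10.1142/s0218202520500141, doi:10.1103/physrevlett.132.104002, doi:10.1088/1361-6544/adf605, ThalabardBecMailybaev2020)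

History (route lifecycle, newest last):
- 2026-08-16T23:18:50Z · rev 8: restated Assembly (stmt-AtomisticToContinuum-9262 proved) — route-repair follow-up (retype p126922): restate the Assembly item as the frame statement X₊ → Statement, `MeanFluxClosure → MeanSecondLaw → HydrodynamicLimit`. (planner-rrepair-AtomisticToContinuum-AnnealedZ-6709221e-0)
- 2026-08-17T09:30:49Z · BROKEN — MeanSecondLaw (stmt-AtomisticToContinuum-9257, crux) refuted by Summit.AtomisticToContinuum.HydrodynamicLimit.Theorems.not_MeanSecondLaw @ f1757b98b06c (prover-line-stmt-AtomisticToContinuum-9257-c2-0)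
- 2026-08-17T10:20:13Z · rev 11: restated Assembly (stmt-AtomisticToContinuum-17421) — route-repair (rrefute-AtomisticToContinuum-AnnealedZ-2798150d): MeanSecondLaw (stmt-9257, crux r4) refuted-MISSTATED by Theorems.not_MeanSecondLaw (p151609; jun (planner-rrefute-AtomisticToContinuum-AnnealedZ-2798150d-0)
- 2026-08-17T10:20:13Z · rev 11: dropped MeanSecondLaw, AnnealedWeakStrong — route-repair (rrefute-AtomisticToContinuum-AnnealedZ-2798150d): MeanSecondLaw (stmt-9257, crux r4) refuted-MISSTATED by Theorems.not_MeanSecondLaw (p151609; jun (planner-rrefute-AtomisticToContinuum-AnnealedZ-2798150d-0)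
- 2026-08-17T10:20:13Z · REPAIRED (restate Assembly; drop MeanSecondLaw, AnnealedWeakStrong; add MeanMomentumClosureCut, MeanLocalSecondLaw, AnnealedWeakSt) — back to open: route-repair (rrefute-AtomisticToContinuum-AnnealedZ-2798150d): MeanSecondLaw (stmt-9257, crux r4) refuted-MISSTATED by Theorems.not_MeanSecondLaw (p151609; jun (planner-rrefute-AtomisticToContinuum-AnnealedZ-2798150d-0)
- 2026-08-17T10:21:07Z · rev 11: dropped MeanFluxClosure — route-repair (2798150d) step 1b: DROP MeanFluxClosure (stmt-9256) to clear the unrenderable 'aside' badge recorded at 10:19Z (gate KeyError: 'aside' on every la (planner-rrefute-AtomisticToContinuum-AnnealedZ-2798150d-0)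
- 2026-08-17T10:26:07Z · rev 12: restated Assembly (stmt-AtomisticToContinuum-18013) — route-repair (2798150d) step 2b: (i) restate the Assembly record stmt-18013 (closes-shaped arrow, gate flag ground.trivial: tauto, blocking) to the frame statem (planner-rrefute-AtomisticToContinuum-AnnealedZ-2798150d-0)
- 2026-08-26T14:19:22Z · DORMANT — reconciler: no traction for 6.6 d (last activity item-proof-filed at 2026-08-19T22:25:47Z); parked, not closed — `ledger route dormant route-AtomisticToContinuu (operator:999:1743922)

sub-problem: HydrodynamicLimit · status: dormant · opened planner-plancard-AtomisticToContinuum-Hydrody-08149edb-0 2026-08-15T13:54:49Z · rev 12 · ledger route-AtomisticToContinuum-AnnealedZeroHorizon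
GENERATED by the gate from the ledger (D-0016/17). Provers cite these decls: `theorem foo : Summit.AtomisticToContinuum.HydrodynamicLimit.Theses.AnnealedZeroHorizon.<Decl> := …` in Summits/AtomisticToContinuum/HydrodynamicLimit/Theorems/<Name>.lean.
-/

namespace Summit.AtomisticToContinuum.HydrodynamicLimit.Theses.AnnealedZeroHorizon

open scoped BigOperators Topology Manifold Classical MeasureTheory ProbabilityTheory Matrix InnerProductSpace ComplexConjugate ContinuousMap
open Filter Set Function TopologicalSpace MeasureTheory

attribute [summit_statement] _root_.HydrodynamicLimit

/-- item stmt-AtomisticToContinuum-9255 · crux · rank 2 · open · by planner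
why it might fail: hs-Euler slip surfaces from generic smooth data might be born with macroscopic width (horizon ≍ log N as for smooth shear); compressibility/density ratio only delay onset by a constant factor (OnsetLawR; BDB1975, BalsaGoldstein1990), but nonlinear saturation could keep the spread o(1).
sources: ThalabardBecMailybaev2020, BandakEtAl2024, EyinkPeng2025, Miles1958, FejerMiles1963, CoulombelSecchi2004
[crux] (card Z1, zero-horizon variance explosion, in centring form) there are continuous positive
profiles (a₀, θ₀) and u₀, a time t > 0, a continuous χ and δ > 0 such that for every σ₀ > 0 some
reduced density 0 < σ < σ₀ has: for every family of hard-sphere flows and EVERY deterministic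
centring c : ℕ → V3, frequently in N the local Gibbs law gives probability ≥ δ to {‖⟨empirical
momentum field at time t, χ⟩ − c_N‖ > δ}. Equivalently two independent realisations differ by O(1)
with non-vanishing probability; intended witness: smoothed four-quadrant / oblique-shock data on 𝕋³
(functions of two coordinates) whose hs-Euler evolution produces a SUBSONIC slip surface at T_s,
observed at any fixed t > T_s. [difficulty: open-problem] -/
@[route_item "route-AtomisticToContinuum-AnnealedZeroHorizon"]
def ZeroHorizonSpread : Prop :=
  ∃ (a₀ θ₀ : Literature.MathematicalPhysics.KineticTheory.T3 → ℝ) (u₀ : Literature.MathematicalPhysics.KineticTheory.T3 → Literature.MathematicalPhysics.KineticTheory.V3), Continuous a₀ ∧ Continuous θ₀ ∧ Continuous u₀ ∧ (∀ x, 0 < a₀ x) ∧ (∀ x, 0 < θ₀ x) ∧ ∃ t : ℝ, 0 < t ∧ ∃ χ : Literature.MathematicalPhysics.KineticTheory.T3 → ℝ, Continuous χ ∧ ∃ δ : ℝ, 0 < δ ∧ ∀ σ₀ : ℝ, 0 < σ₀ → ∃ σ : ℝ, 0 < σ ∧ σ < σ₀ ∧ ∀ Φ : (N : ℕ) → Literature.Analysis.FluidPDE.HardSphereFlow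 (Literature.Analysis.FluidPDE.Torus.geometry (Fin 3)) (Literature.MathematicalPhysics.KineticTheory.hsDiameter σ N) (N + 1), ∀ c : ℕ → Literature.MathematicalPhysics.KineticTheory.V3, ∃ᶠ N in Filter.atTop, ENNReal.ofReal δ ≤ Literature.MathematicalPhysics.KineticTheory.localGibbsLaw σ a₀ u₀ θ₀ N (Φ N) {z | δ < ‖Literature.MathematicalPhysics.KineticTheory.empiricalMomentumField ((Φ N).flow t z) χ - c N‖}

/-- item stmt-AtomisticToContinuum-18014 · crux · rank 3 · open · by planner
why it might fail: Local equilibrium IN MEAN of the deterministic momentum current at fixed σ (traceless window velocity covariance + collisional virial → ρθ(Z−1)𝟙) with no mixing theorem (Spohn1991 §3.3; OVY93 need noise); the untied all-time form must also absorb sub-kernel Reynolds stresses after shocks as ℓ → 0.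
sources: Spohn1991, OllaVaradhanYau1993, BrezinaFeireisl2018, KipnisLandim1999, NachtergaeleYau2003, Literature.Barriers.AtomisticToContinuum.BoltzmannHypothesisBarrierNarrow
[crux] ANNEALED MOMENTUM-FLUX CLOSURE ON THE CUT PRESSURE, kernel format, space-time test fields
(NEW 2026-08-17 repair; the annealed, continuous-kernel, UNTIED all-time twin of
BoxDissipativeWeakStrong.FluxClosure; supersedes the momentum clause of MeanFluxClosure on the
load-bearing path; text = the AWS leads' `Cruxes/AnnealedWeakStrong/RETYPE_c2.lean` K1ker with two
planner changes: bands `∃ η_c ∀ η₁ < η_c` instead of `∀ η₁ > 0`, and uniformity in τ ∈ [0,T₁]). ∃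
η_c > 0 such that for every band 0 < η₁ < η_c and all continuous positive profiles (a₀,θ₀), u₀ there
is σ₀ > 0 with: for 0 < σ < σ₀, every family of hard-sphere flows Φ, every horizon T′ > 0, every
smooth space-time vector field w on [0,T′)×𝕋³ (Torus.IsSmoothSpaceTimeOn (Ico 0 T′)), every T₁ ∈
[0,T′) and ε > 0 there is a kernel radius ℓ > 0 such that for every continuous probability kernel k
supported in the minimal-image ℓ-ball (verbatim AWS.IsKernel), eventually in N, FOR ALL τ ∈ [0,T₁]:
the pathwise momentum-balance defect D(z) = ⟨m^k(τ), w(τ)⟩ − ⟨m^k(0), w(0)⟩ − ∫_{(0,τ]}∫_𝕋³ (m^k·∂ₜw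
+ Σᵢⱼ m^k_i m^k_j/ρ^k ∂ⱼwᵢ + p_cut div w) dx ds of the k-mollified empirical fields (ρ^k, m^k, E^k)
of the time-s configuration (verba -/
@[route_item "route-AtomisticToContinuum-AnnealedZeroHorizon", crux]
def MeanMomentumClosureCut : Prop :=
  ∃ ηc : ℝ, 0 < ηc ∧ ∀ η₁ : ℝ, 0 < η₁ → η₁ < ηc → ∀ (a₀ θ₀ : Literature.MathematicalPhysics.KineticTheory.T3 → ℝ) (u₀ : Literature.MathematicalPhysics.KineticTheory.T3 → Literature.MathematicalPhysics.KineticTheory.V3), Continuous a₀ → Continuous θ₀ → Continuous u₀ → (∀ x, 0 < a₀ x) → (∀ x, 0 < θ₀ x) → ∃ σ₀ : ℝ, 0 < σ₀ ∧ ∀ σ : ℝ, 0 < σ → σ < σ₀ → ∀ Φ : (N : ℕ) → Literature.Analysis.FluidPDE.HardSphereFlow (Literature.Analysis.FluidPDE.Torus.geometry (Fin 3)) (Literature.MathematicalPhysics.KineticTheory.hsDiameter σ N) (N + 1), ∀ T' : ℝ, 0 < T' → ∀ w : ℝ → Literature.MathematicalPhysics.KineticTheory.T3 → Literature.MathematicalPhysics.KineticTheory.V3,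 Literature.Analysis.FunctionSpaces.Torus.IsSmoothSpaceTimeOn (Ico 0 T') w → ∀ T₁ : ℝ, 0 ≤ T₁ → T₁ < T' → ∀ ε : ℝ, 0 < ε → ∃ ℓ : ℝ, 0 < ℓ ∧ ∀ k : Literature.MathematicalPhysics.KineticTheory.T3 → ℝ, (Continuous k ∧ (∀ y, 0 ≤ k y) ∧ (∫ y, k y = 1) ∧ (∀ y, k y ≠ 0 → Literature.Analysis.FluidPDE.Torus.euclidDist y 0 < ℓ)) → ∀ᶠ N in Filter.atTop, ∀ τ ∈ Icc 0 T₁, let R := fun s z x => Literature.MathematicalPhysics.KineticTheory.empiricalDensityField ((Φ N).flow s z) (fun y => k (x - y)); let Mv := fun s z x => Literature.MathematicalPhysics.KineticTheory.empiricalMomentumField ((Φ N).flow s z) (fun y => k (x - y)); let En := fun s z x => Literature.MathematicalPhysics.KineticTheory.empiricalEnergyField ((Φ N).flow s z) (fun y => k (x - y)); let D : Literature.Analysis.FluidPDE.Config (N + 1) (Fin 3) Literature.MathematicalPhysics.KineticTheory.T3 → ℝ := fun z => (∫ x, inner ℝ (Mv τ z x) (w τ x)) - (∫ x, inner ℝ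 (Mv 0 z x) (w 0 x)) - ∫ s in Ioc 0 τ, ∫ x, (inner ℝ (Mv s z x) (Literature.Analysis.FunctionSpaces.Torus.timeDerivWithin (Ico 0 T') w s x) + (∑ i, ∑ j, Mv s z x i * Mv s z x j / R s z x * Literature.Analysis.FunctionSpaces.Torus.partialDeriv j (fun y => w s y i) x) + R s z x * (2 / 3 * (En s z x / R s z x - ‖Mv s z x‖ ^ 2 / (2 * R s z x ^ 2))) * Literature.MathematicalPhysics.KineticTheory.hsCompressibility (min (R s z x * σ ^ 3) η₁) * Literature.Analysis.FunctionSpaces.Torus.divergence (w s) x); MeasureTheory.Integrable D (Literature.MathematicalPhysics.KineticTheory.localGibbsLaw σ a₀ u₀ θ₀ N (Φ N)) ∧ |∫ z, D z ∂Literature.MathematicalPhysics.KineticTheory.localGibbsLaw σ a₀ u₀ θ₀ N (Φ N)| ≤ ε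

/-- item stmt-AtomisticToContinuum-18015 · crux · rank 4 · open · by planner
why it might fail: No H-theorem for deterministic spheres: a LOCAL clamped second law in mean needs entropy flux = Z(ŝ)m^k (no Euler-order heat current) and near-local-equilibrium window statistics at positive times; ρs is concave, so unresolved sub-kernel fluctuations push the mean defect the wrong way.
sources: BrezinaFeireisl2018, FeireislNovotny2012, ChenFrid2000, Georgii1994, Spohn1991, FjordholmEtAl2020
[crux] THE RESTATED MeanSecondLaw (stmt-AtomisticToContinuum-9257, refuted-misstated 2026-08-17 by
Theorems.not_MeanSecondLaw, p151609; class misstated): ANNEALED LOCAL CLAMP-RENORMALISED SECOND LAW,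
kernel format (the annealed, continuous-kernel, untied all-time twin of
BoxDissipativeWeakStrong.EntropyAdmissibility; text = RETYPE_c2.lean K2ker with bands `∃ η_c ∀ η₁ <
η_c`, clamps quantified after σ, uniformity in τ ∈ [0,T₁]). Same frame as MeanMomentumClosureCut (∃
η_c ∀ η₁ < η_c ∀ profiles ∃ σ₀ ∀ σ < σ₀ ∀ Φ ∀ T′ > 0); then for all reals a < b, every smooth
space-time function φ ≥ 0 on [0,T′)×𝕋³, every T₁ ∈ [0,T′) and ε > 0 there is ℓ > 0 such that for
every kernel in the ℓ-ball, eventually in N, for all τ ∈ [0,T₁]: the renormalised entropy-balance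
defect D(z) = ∫_{(0,τ]}∫ (ρ^k Z_{a,b}(ŝ) ∂ₜφ + Z_{a,b}(ŝ) m^k·∇φ) dx ds − ∫ ρ^k Z_{a,b}(ŝ) φ dx|_τ +
∫ ρ^k Z_{a,b}(ŝ) φ dx|_0 — ŝ = 3/2 log θ^k − log ρ^k − F_cut(ρ^kσ³) the window entropy per particle
with the Gibbs-consistent CUT excess free energy F_cut(η) = f_ex(min η η₁) + (Z(η₁) − 1) log(max η
η₁/η₁) (C¹, its pressure is exactly p_cut), Z_{a,b}(s) = max a (min s b) — is integrable under the
local Gibbs law with MEAN ≤ ε. For exact -/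
@[route_item "route-AtomisticToContinuum-AnnealedZeroHorizon", crux]
def MeanLocalSecondLaw : Prop :=
  ∃ ηc : ℝ, 0 < ηc ∧ ∀ η₁ : ℝ, 0 < η₁ → η₁ < ηc → ∀ (a₀ θ₀ : Literature.MathematicalPhysics.KineticTheory.T3 → ℝ) (u₀ : Literature.MathematicalPhysics.KineticTheory.T3 → Literature.MathematicalPhysics.KineticTheory.V3), Continuous a₀ → Continuous θ₀ → Continuous u₀ → (∀ x, 0 < a₀ x) → (∀ x, 0 < θ₀ x) → ∃ σ₀ : ℝ, 0 < σ₀ ∧ ∀ σ : ℝ, 0 < σ → σ < σ₀ → ∀ Φ : (N : ℕ) → Literature.Analysis.FluidPDE.HardSphereFlow (Literature.Analysis.FluidPDE.Torus.geometry (Fin 3)) (Literature.MathematicalPhysics.KineticTheory.hsDiameter σ N) (N + 1), ∀ T' : ℝ, 0 < T' → ∀ a b : ℝ, a < b → ∀ φ : ℝ → Literature.MathematicalPhysics.KineticTheory.T3 → ℝ, Literature.Analysis.FunctionSpaces.Torus.IsSmoothSpaceTimeOn (Ico 0 T') φ → (∀ t ∈ Ico 0 T', ∀ x, 0 ≤ φ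 t x) → ∀ T₁ : ℝ, 0 ≤ T₁ → T₁ < T' → ∀ ε : ℝ, 0 < ε → ∃ ℓ : ℝ, 0 < ℓ ∧ ∀ k : Literature.MathematicalPhysics.KineticTheory.T3 → ℝ, (Continuous k ∧ (∀ y, 0 ≤ k y) ∧ (∫ y, k y = 1) ∧ (∀ y, k y ≠ 0 → Literature.Analysis.FluidPDE.Torus.euclidDist y 0 < ℓ)) → ∀ᶠ N in Filter.atTop, ∀ τ ∈ Icc 0 T₁, let R := fun s z x => Literature.MathematicalPhysics.KineticTheory.empiricalDensityField ((Φ N).flow s z) (fun y => k (x - y)); let Mv := fun s z x => Literature.MathematicalPhysics.KineticTheory.empiricalMomentumField ((Φ N).flow s z) (fun y => k (x - y)); let En := fun s z x => Literature.MathematicalPhysics.KineticTheory.empiricalEnergyField ((Φ N).flow s z) (fun y => k (x - y)); let Zs := fun s z x => max a (min (3 / 2 * Real.log (2 / 3 * (En s z x / R s z x - ‖Mv s z x‖ ^ 2 / (2 * R s z x ^ 2))) - Real.log (R s z x) - (Literature.MathematicalPhysics.KineticTheory.hsExcessFreeEnergy (min (R s z x * σ ^ 3) η₁) + (Literature.MathematicalPhysics.KineticTheory.hsCompressibility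 η₁ - 1) * Real.log (max (R s z x * σ ^ 3) η₁ / η₁))) b); let D : Literature.Analysis.FluidPDE.Config (N + 1) (Fin 3) Literature.MathematicalPhysics.KineticTheory.T3 → ℝ := fun z => (∫ s in Ioc 0 τ, ∫ x, (R s z x * Zs s z x * Literature.Analysis.FunctionSpaces.Torus.timeDerivWithin (Ico 0 T') φ s x + Zs s z x * inner ℝ (Mv s z x) (Literature.Analysis.FunctionSpaces.Torus.gradient (φ s) x))) - (∫ x, R τ z x * Zs τ z x * φ τ x) + (∫ x, R 0 z x * Zs 0 z x * φ 0 x); MeasureTheory.Integrable D (Literature.MathematicalPhysics.KineticTheory.localGibbsLaw σ a₀ u₀ θ₀ N (Φ N)) ∧ ∫ z, D z ∂Literature.MathematicalPhysics.KineticTheory.localGibbsLaw σ a₀ u₀ θ₀ N (Φ N) ≤ ε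

/-- item stmt-AtomisticToContinuum-18016 · crux · rank 5 · open · by planner
why it might fail: BF18 Thm 3.3 un-clamps by an a.s. entropy minimum principle and uses bounded-support Young measures; here vacuum/cold/dense windows are charged at finite N and only MEAN defects are known: coercivity of the clamped relative energy ℰ_{Z_{a,b}} for the cut EOS on all window states is unprinted.
sources: BrezinaFeireisl2018, BrezinaFeireisl2018Revisited, FeireislNovotny2012, FeireislLukacovamedvidovaMizerova2018, Dafermos1979, FjordholmEtAl2020
[crux] ANNEALED WEAK–STRONG, RE-TYPED (NEW 2026-08-17; replaces AnnealedWeakStrong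
stmt-AtomisticToContinuum-9258, which became vacuously provable (ex falso from not_MeanSecondLaw)
and was declared `verdict: misstated` by three leads — its GLOBAL second law could not be consumed:
Cruxes/AnnealedWeakStrong/LeadC1-S2-dossier.md, LeadC2-verdict.md, LeadC3-verdict.md, RETYPE_c2.lean
`AnnealedWeakStrongRetyped`). MeanMomentumClosureCut → MeanLocalSecondLaw → [VERBATIM the
packing-guarded sub-problem Statement body, as in the old item: ∃ η₀ > 0 such that for all
continuous positive profiles ∃ σ₀ > 0 ∀ 0 < σ < σ₀, every classical hs-Euler solution (ρ,u,θ) on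
[0,T) with ρ_t(x)σ³ < η₀ throughout and every flow family whose local Gibbs fields converge in
probability at t = 0 has fields converging in probability at every t < T], so `closes hMMC hMLS hAWS
:= hAWS hMMC hMLS : HydrodynamicLimit` by unfolding. Intended proof (the leads' R-B): obtain η_c,
η_c′ from the two hypotheses, fix the band η₁ := min(η_c, η_c′)/2 and answer the Statement's ∃ η₀
with η₀ := η₁/2; per (profiles) take σ₀ := the min of the hypotheses' σ₀(η₁, profiles) and of the
EOS needs; per (σ, solution on [0,T), t < T): Břez -/
@[route_item "route-AtomisticToContinuum-AnnealedZeroHorizon", crux]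
def AnnealedWeakStrongR : Prop :=
  MeanMomentumClosureCut → MeanLocalSecondLaw → ∃ η₀ : ℝ, 0 < η₀ ∧ ∀ (a₀ θ₀ : Literature.MathematicalPhysics.KineticTheory.T3 → ℝ) (u₀ : Literature.MathematicalPhysics.KineticTheory.T3 → Literature.MathematicalPhysics.KineticTheory.V3), Continuous a₀ → Continuous θ₀ → Continuous u₀ → (∀ x, 0 < a₀ x) → (∀ x, 0 < θ₀ x) → ∃ σ₀ : ℝ, 0 < σ₀ ∧ ∀ σ : ℝ, 0 < σ → σ < σ₀ → ∀ (T : ℝ) (ρ θ : ℝ → Literature.MathematicalPhysics.KineticTheory.T3 → ℝ) (u : ℝ → Literature.MathematicalPhysics.KineticTheory.T3 → Literature.MathematicalPhysics.KineticTheory.V3), Literature.MathematicalPhysics.KineticTheory.IsHardSphereEulerSolution σ T ρ u θ → (∀ t ∈ Set.Ico 0 T, ∀ x, ρ t x * σ ^ 3 < η₀) → ∀ Φ : (N : ℕ) → Literature.Analysis.FluidPDE.HardSphereFlow (Literature.Analysis.FluidPDE.Torus.geometry (Fin 3)) (Literature.MathematicalPhysics.KineticTheory.hsDiameter σ N) (N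 + 1), Literature.MathematicalPhysics.KineticTheory.TendstoHydroFieldsAt (fun N => Literature.MathematicalPhysics.KineticTheory.localGibbsLaw σ a₀ u₀ θ₀ N (Φ N)) Φ ρ u θ 0 → ∀ t ∈ Set.Ico 0 T, Literature.MathematicalPhysics.KineticTheory.TendstoHydroFieldsAt (fun N => Literature.MathematicalPhysics.KineticTheory.localGibbsLaw σ a₀ u₀ θ₀ N (Φ N)) Φ ρ u θ t

-- item stmt-AtomisticToContinuum-13797 · crux · rank 6 · open · by planner — informal only, no Lean statement yet:
--   [crux] ONSET LAW, repaired (card Z4; replaces OnsetLaw stmt-AtomisticToContinuum-9502,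
--   refuted-misstated 2026-08-15: its 2-D supersonic clause 'ΔU > 2√2·c ⇒ G at most algebraic, no O(1)
--   before t ≳ log N' is false — 2√2·c is only the zero-thickness sheet threshold M_CR
--   (CriminaleJacksonJoslin2018 (5.56)); layers of nonzero width are unstable at every Mach number via
--   radiating fast/slow modes (BlumenDrazinBillings1975; CriminaleJacksonJoslin2018 §5.2; rates ∝ M_c⁻²
--   > 0, BalsaGoldstein1990). That clause is deleted; the law below is asserted at ALL Mach numbers,
--   density ratios and d ∈ {2,3}.) SETT

/-- item stmt-AtomisticToContinuum-3091 · support · rank 9 · open · by planner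
why it might fail: owned by route ImplosionLoophole: its negation DenseExcursion (implosion tracking) is a live crux there.
sources: Sideris1985, LukSpeck2024, CaolaboraEtAl2025, BuckmasterCaolaboraGomezserrano2025
[crux] (card crux 1B ∪ 3; the hidden PDE crux of every route) for every η > 0 and all continuous
positive profiles there is σ₀ > 0 such that for 0 < σ < σ₀, every classical hard-sphere-Euler
solution on [0,T) whose t = 0 fields are the LLN limit of the local Gibbs laws satisfies ρ_t(x)σ³ <
η for all t < T and x — i.e. limsup_{σ→0} σ³ sup_{t<T*_σ} ‖ρ_σ(t)‖_∞ = 0 profile by profile. For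
profiles whose ideal-gas development is global or breaks by a non-degenerate shock (Luk–Speck /
Buckmaster–Shkoller–Vicol open sets) this is stability of shock formation under an O(σ³)
equation-of-state and data perturbation; in general it is a σ-uniform density bound at the FIRST
singularity of 3-D compressible Euler for all smooth data. [deps: EosContinuity,
LocalGibbsDensityLimit] [difficulty: open-problem] -/
@[route_item "route-AtomisticToContinuum-AnnealedZeroHorizon"]
def DiluteSelfConsistency : Prop :=
  ∀ η : ℝ, 0 < η → ∀ (a₀ θ₀ : Literature.MathematicalPhysics.KineticTheory.T3 → ℝ) (u₀ : Literature.MathematicalPhysics.KineticTheory.T3 → Literature.MathematicalPhysics.KineticTheory.V3), Continuous a₀ → Continuous θ₀ → Continuous u₀ → (∀ x, 0 < a₀ x) → (∀ x, 0 < θ₀ x) → ∃ σ₀ : ℝ, 0 < σ₀ ∧ ∀ σ : ℝ, 0 < σ → σ < σ₀ → ∀ (T : ℝ) (ρ θ : ℝ → Literature.MathematicalPhysics.KineticTheory.T3 → ℝ) (u : ℝ → Literature.MathematicalPhysics.KineticTheory.T3 → Literature.MathematicalPhysics.KineticTheory.V3), Literature.MathematicalPhysics.KineticTheory.IsHardSphereEulerSolution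 σ T ρ u θ → ∀ Φ : (N : ℕ) → Literature.Analysis.FluidPDE.HardSphereFlow (Literature.Analysis.FluidPDE.Torus.geometry (Fin 3)) (Literature.MathematicalPhysics.KineticTheory.hsDiameter σ N) (N + 1), Literature.MathematicalPhysics.KineticTheory.TendstoHydroFieldsAt (fun N => Literature.MathematicalPhysics.KineticTheory.localGibbsLaw σ a₀ u₀ θ₀ N (Φ N)) Φ ρ u θ 0 → ∀ t ∈ Set.Ico 0 T, ∀ x, ρ t x * σ ^ 3 < η

/-- item stmt-AtomisticToContinuum-9259 · support · rank 9 · closed · proved by Summit.AtomisticToContinuum.HydrodynamicLimit.Theorems.massContinuity_proof @ 98fbf36d5a5c (prover) · by planner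
sources: GST2013, Alexander1975, Spohn1991
[support] (exact continuity equation in the same annealed format; provable from the HardSphereFlow
trajectory axioms alone) for every σ > 0, continuous positive profiles, flow family, N, t₁ ≤ t₂ and
smooth ψ, the pathwise defect ⟨ρ_N(t₂),ψ⟩ − ⟨ρ_N(t₁),ψ⟩ − ∫_{t₁}^{t₂} Σᵢ ⟨m_N(s), ∂ᵢψ⟩ᵢ ds is
integrable under the local Gibbs law with integral 0: it vanishes identically on the good set (free
flight + continuity of positions, FTC for piecewise-C¹ s ↦ ψ(x_k(s))) and the law is absolutely
continuous w.r.t. Liouville (particleLaw = withDensity). Feeds the mass equation to the prover of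
AnnealedWeakStrong. [difficulty: M] -/
@[route_item "route-AtomisticToContinuum-AnnealedZeroHorizon"]
def MassContinuity : Prop :=
  ∀ σ : ℝ, 0 < σ → ∀ (a₀ θ₀ : Literature.MathematicalPhysics.KineticTheory.T3 → ℝ) (u₀ : Literature.MathematicalPhysics.KineticTheory.T3 → Literature.MathematicalPhysics.KineticTheory.V3), Continuous a₀ → Continuous θ₀ → Continuous u₀ → (∀ x, 0 < a₀ x) → (∀ x, 0 < θ₀ x) → ∀ Φ : (N : ℕ) → Literature.Analysis.FluidPDE.HardSphereFlow (Literature.Analysis.FluidPDE.Torus.geometry (Fin 3)) (Literature.MathematicalPhysics.KineticTheory.hsDiameter σ N) (N + 1), ∀ (N : ℕ) (t₁ t₂ : ℝ), t₁ ≤ t₂ → ∀ ψ : Literature.MathematicalPhysics.KineticTheory.T3 → ℝ, Literature.Analysis.FunctionSpaces.Torus.IsSmooth ψ → let D : Literature.Analysis.FluidPDE.Config (N + 1) (Fin 3) Literature.MathematicalPhysics.KineticTheory.T3 → ℝ := fun z => (Literature.MathematicalPhysics.KineticTheory.empiricalDensityField ((Φ N).flow t₂ z) ψ - Literature.MathematicalPhysics.KineticTheory.empiricalDensityField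 ((Φ N).flow t₁ z) ψ) - ∫ s in t₁..t₂, (∑ i, (Literature.MathematicalPhysics.KineticTheory.empiricalMomentumField ((Φ N).flow s z) (fun y => Literature.Analysis.FunctionSpaces.Torus.partialDeriv i ψ y)) i); MeasureTheory.Integrable D (Literature.MathematicalPhysics.KineticTheory.localGibbsLaw σ a₀ u₀ θ₀ N (Φ N)) ∧ ∫ z, D z ∂Literature.MathematicalPhysics.KineticTheory.localGibbsLaw σ a₀ u₀ θ₀ N (Φ N) = 0

-- `MassContinuity` holds: proved by `Summit.AtomisticToContinuum.HydrodynamicLimit.Theorems.massContinuity_proof` @ 98fbf36d5a5c (its module imports this route file, so no `_holds` link can be stated here).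

/-- item stmt-AtomisticToContinuum-9260 · support · rank 9 · closed · proved by Summit.AtomisticToContinuum.HydrodynamicLimit.Theorems.spreadExcludesLimit_proof @ b1634edc3df5 (prover) · by planner
sources: Spohn1991
[support] (glue, provable now; proof in the planner's Sketch.lean) for any laws P_N, flows, time t,
continuous χ and δ > 0: if for every centring c : ℕ → V3 frequently P_N{‖⟨m_N(t),χ⟩ − c_N‖ > δ} ≥ δ,
then NO fields (ρ,u,θ) whatsoever satisfy TendstoHydroFieldsAt P Φ ρ u θ t. Makes ZeroHorizonSpread
a typed refutation of every deterministic description at time t (classical, weak, mv-barycentre …).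
[difficulty: provable-now] -/
@[route_item "route-AtomisticToContinuum-AnnealedZeroHorizon"]
def SpreadExcludesLimit : Prop :=
  ∀ (ε : ℕ → ℝ) (P : (N : ℕ) → MeasureTheory.Measure (Literature.Analysis.FluidPDE.Config (N + 1) (Fin 3) Literature.MathematicalPhysics.KineticTheory.T3)) (Φ : (N : ℕ) → Literature.Analysis.FluidPDE.HardSphereFlow (Literature.Analysis.FluidPDE.Torus.geometry (Fin 3)) (ε N) (N + 1)) (t : ℝ) (χ : Literature.MathematicalPhysics.KineticTheory.T3 → ℝ) (δ : ℝ), Continuous χ → 0 < δ → (∀ c : ℕ → Literature.MathematicalPhysics.KineticTheory.V3, ∃ᶠ N in Filter.atTop, ENNReal.ofReal δ ≤ P N {z | δ < ‖Literature.MathematicalPhysics.KineticTheory.empiricalMomentumField ((Φ N).flow t z) χ - c N‖}) → ∀ (ρ θ : ℝ → Literature.MathematicalPhysics.KineticTheory.T3 → ℝ) (u : ℝ → Literature.MathematicalPhysics.KineticTheory.T3 → Literature.MathematicalPhysics.KineticTheory.V3), ¬ Literature.MathematicalPhysics.KineticTheory.TendstoHydroFieldsAt P Φ ρ u θ t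

-- `SpreadExcludesLimit` holds: proved by `Summit.AtomisticToContinuum.HydrodynamicLimit.Theorems.spreadExcludesLimit_proof` @ b1634edc3df5 (its module imports this route file, so no `_holds` link can be stated here).

/-- item stmt-AtomisticToContinuum-9261 · support · rank 9 · closed · proved by Summit.AtomisticToContinuum.HydrodynamicLimit.Theorems.spreadBoundsClassicalTime_proof (prover) · by planner
sources: Spohn1991, Sideris1985
[support] (glue, provable now; proof in Sketch.lean) if HydrodynamicLimitFor σ holds and the spread
of ZeroHorizonSpread occurs at (σ, profiles, t ≥ 0, χ, δ) for a flow family Φ, then every classical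
hs-Euler solution on [0,T) whose time-0 fields are the local-Gibbs LLN limit along Φ has T ≤ t:
under the conjunct, randomisation by time t is a particle-level certificate of classical breakdown
before t (contrapositive: global classical solutions ⇒ no spread ever). [difficulty: provable-now] -/
@[route_item "route-AtomisticToContinuum-AnnealedZeroHorizon"]
def SpreadBoundsClassicalTime : Prop :=
  ∀ σ : ℝ, Literature.MathematicalPhysics.KineticTheory.HydrodynamicLimitFor σ → ∀ (a₀ θ₀ : Literature.MathematicalPhysics.KineticTheory.T3 → ℝ) (u₀ : Literature.MathematicalPhysics.KineticTheory.T3 → Literature.MathematicalPhysics.KineticTheory.V3), Continuous a₀ → Continuous θ₀ → Continuous u₀ → (∀ x, 0 < a₀ x) → (∀ x, 0 < θ₀ x) → ∀ (t : ℝ) (χ : Literature.MathematicalPhysics.KineticTheory.T3 → ℝ) (δ : ℝ), 0 ≤ t → Continuous χ → 0 < δ → ∀ Φ : (N : ℕ) → Literature.Analysis.FluidPDE.HardSphereFlow (Literature.Analysis.FluidPDE.Torus.geometry (Fin 3)) (Literature.MathematicalPhysics.KineticTheory.hsDiameter σ N) (N + 1), (∀ c : ℕ → Literature.MathematicalPhysics.KineticTheory.V3,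 ∃ᶠ N in Filter.atTop, ENNReal.ofReal δ ≤ Literature.MathematicalPhysics.KineticTheory.localGibbsLaw σ a₀ u₀ θ₀ N (Φ N) {z | δ < ‖Literature.MathematicalPhysics.KineticTheory.empiricalMomentumField ((Φ N).flow t z) χ - c N‖}) → ∀ (T : ℝ) (ρ θ : ℝ → Literature.MathematicalPhysics.KineticTheory.T3 → ℝ) (u : ℝ → Literature.MathematicalPhysics.KineticTheory.T3 → Literature.MathematicalPhysics.KineticTheory.V3), Literature.MathematicalPhysics.KineticTheory.IsHardSphereEulerSolution σ T ρ u θ → Literature.MathematicalPhysics.KineticTheory.TendstoHydroFieldsAt (fun N => Literature.MathematicalPhysics.KineticTheory.localGibbsLaw σ a₀ u₀ θ₀ N (Φ N)) Φ ρ u θ 0 → T ≤ t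

-- `SpreadBoundsClassicalTime` holds: proved by `Summit.AtomisticToContinuum.HydrodynamicLimit.Theorems.spreadBoundsClassicalTime_proof` (its module imports this route file, so no `_holds` link can be stated here).

-- earlier Assembly (stmt-AtomisticToContinuum-17421, replaced 2026-08-17T10:20:13Z -> stmt-AtomisticToContinuum-18013): retired by None — MeanFluxClosure → MeanSecondLaw → HydrodynamicLimit
-- earlier Assembly (stmt-AtomisticToContinuum-18013, replaced 2026-08-17T10:26:07Z -> stmt-AtomisticToContinuum-18018): retired by None — MeanMomentumClosureCut → MeanLocalSecondLaw → AnnealedWeakStrongR → HydrodynamicLimit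
-- earlier Assembly (stmt-AtomisticToContinuum-9262, replaced 2026-08-16T23:18:50Z -> stmt-AtomisticToContinuum-17421): proved by Summit.AtomisticToContinuum.HydrodynamicLimit.Theorems.annealedZeroHorizon_assembly_proof @ db2079850acb — MeanFluxClosure → MeanSecondLaw → AnnealedWeakStrong → DiluteSelfConsistency → HydrodynamicLimit
/-- item stmt-AtomisticToContinuum-18018 · assembly · rank 1 · open · by planner
sources: FjordholmEtAl2020, Spohn1991, OllaVaradhanYau1993
[assembly] frame statement X₊ → Statement (restated 2026-08-17, second pass): the annealed kernel
inputs MeanMomentumClosureCut (law-averaged momentum-flux closure on the cut pressure) and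
MeanLocalSecondLaw (law-averaged local clamp-renormalised second law, the restated MeanSecondLaw)
imply the packing-guarded hydrodynamic limit `HydrodynamicLimit` (the sub-problem Statement by
name). Definitionally the crux AnnealedWeakStrongR (whose conclusion is VERBATIM the Statement
body), so it is closed by `exact` from any proof of that crux and conversely; it carries the crux's
L-content (Březina–Feireisl relative energy in expectation) and is NOT the deciding theorem — that
is `closes hMMC hMLS hAWS := hAWS hMMC hMLS`. The closes-shaped arrow `MeanMomentumClosureCut →
MeanLocalSecondLaw → AnnealedWeakStrongR → HydrodynamicLimit` (stmt-18013, first pass of this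
repair) is a tautology (gate flag ground.trivial: tauto) and was restated to this form, exactly as
stmt-9262 → stmt-17421 on 2026-08-16. History: stmt-9262 `… → AnnealedWeakStrong →
DiluteSelfConsistency → HydrodynamicLimit` (proved, pre-re-type); stmt-17421 `MeanFluxClosure →
MeanSecondLaw → HydrodynamicLimit` (vacuous after not_Me -/
@[route_item "route-AtomisticToContinuum-AnnealedZeroHorizon"]
def Assembly : Prop :=
  MeanMomentumClosureCut → MeanLocalSecondLaw → HydrodynamicLimit

-- records of items no longer active in this route (dropped / restated):
-- earlier MeanSecondLaw (stmt-AtomisticToContinuum-9257, dropped 2026-08-17T10:20:13Z): refuted by Summit.AtomisticToContinuum.HydrodynamicLimit.Theorems.not_MeanSecondLaw @ f1757b98b06c — ∀ (a₀ θ₀ : Literature.MathematicalPhysics.KineticTheory.T3 → ℝ) (u₀ : Literature.MathematicalPhysics.KineticTheory.T3 → Literature.MathematicalPhysics.KineticTheory.V3), Continuous a₀ → Continuous θ₀ → Continuous 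

/-! D-0027 §2.1 — DECIDING THEOREM (planner-authored via `route open/edit --closes-file`; by planner-rrefute-AtomisticToContinuum-AnnealedZ-2798150d-0 2026-08-17T10:20:13Z):
its hypotheses are this route's items and its conclusion the sub-problem Statement (glue_lint), and it elaborates with this file. -/

/-- D-0027 §2.1 deciding theorem (route AnnealedZeroHorizon; 2026-08-17 repair after the refutation of
`MeanSecondLaw`, stmt-AtomisticToContinuum-9257, by `Theorems.not_MeanSecondLaw`, and the three lead
verdicts on `AnnealedWeakStrong`): the route's re-typed positive items decide the sub-problem Statement
`HydrodynamicLimit`, the PACKING-GUARDED conjunct `∃ η₀ > 0, ∀ profiles, ∃ σ₀ > 0, ∀ σ ∈ (0, σ₀),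
∀ T, ∀ classical hs-Euler solutions with ρ_t(x)σ³ < η₀ on [0,T), ∀ Φ, (fields converge at t = 0)
→ (fields converge at every t < T)` (statement re-type p126922, D-0032). The conclusion of
`AnnealedWeakStrongR` is VERBATIM that guarded body, so the deciding theorem is the TERM
`hAWS hMMC hMLS` — `AnnealedWeakStrongR` (Březina–Feireisl relative energy in expectation) applied to
`MeanMomentumClosureCut` (annealed momentum-flux closure on the cut pressure) and `MeanLocalSecondLaw`
(annealed local clamp-renormalised second law, the restated `MeanSecondLaw`); no tactic, nothing that
can drift with the Statement's binder shape. `MeanFluxClosure`, `DiluteSelfConsistency`, the `Assembly`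
record, `ZeroHorizonSpread`, `OnsetLawR` and the Spread / MassContinuity supports are not hypotheses. -/
@[closes "route-AtomisticToContinuum-AnnealedZeroHorizon"] theorem closes (hMMC : MeanMomentumClosureCut) (hMLS : MeanLocalSecondLaw) (hAWS : AnnealedWeakStrongR) :
    HydrodynamicLimit :=
  hAWS hMMC hMLS

end Summit.AtomisticToContinuum.HydrodynamicLimit.Theses.AnnealedZeroHorizon
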